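import Literature.Analysis.FluidPDE.RusinSverakWeakLimitBlowupLeafAssembly
import Literature.Analysis.FluidPDE.RusinSverakCompactnessSevenLeaves
import HarnessLib

/-!
# Rusin–Šverák's weak-limit blow-up over the seven remaining leaves of its cone

Analysis/FluidPDE proof file (no definitions, no named facts) for the named fact
`Literature.Analysis.FluidPDE.rusin_sverak_weak_limit_blowup` (`RusinSverakCompactnessProofs.lean`;
W. Rusin, V. Šverák, *Minimal initial data for potential Navier–Stokes singularities*,
J. Funct. Anal. 260 (2011) 879–891 = arXiv:0911.0500, sentences 2–4 of the proof of **Cor. 4.3**,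
p. 8: a bounded sequence of `Ḣ^{1/2}` blow-up data, normalised by scaling and translation so that
`T_max = 1` with a singular point at `(0, 1)`, has only blow-up data among the weak limits of its
subsequences — Cor. 4.2 applied after the paragraph following Thm. 4.1, "the only reason for
`T_max(u₀) < ∞` is a singularity at `t = T_max`").

The accepted assembly `rusin_sverak_weak_limit_blowup_of_local_leray_leaves`
(`RusinSverakWeakLimitBlowupLeafAssembly.lean`) derives the fact from five named facts of the
local Leray theory: **E** `leray_solution_exists_of_memLp_three`, **U**
`local_leray_weak_strong_uniqueness`, **A** `kato_isLocalLeraySolutionOn`, **F**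
`leray_solution_farField_bound`, **S** `rusin_sverak_leray_singular_points_stable` — the same
five inputs as for Cor. 4.3 itself (`rusin_sverak_minimal_data_compact_of_local_leray_leaves`,
`RusinSverakCompactnessLeafAssembly.lean`). Since then the tree has discharged **A**
(`kato_isLocalLeraySolutionOn_holds`), the ε-regularity criterion
(`lemarieRieusset_epsilon_regularity_holds`), the Calderón–Zygmund bound for the normalised
pressure (`stein1970_normalisedPressure_ae_Lp_bound_holds`), Rusin–Šverák's Prop. 2.2
(`rusin_sverak_2011_proposition_2_2_holds`) and the two CKN inputs of **S**
(`RRS2016.step2_force_holds`, `RRS2016.lemma15_12_holds`), and has reduced **E**, **U**, **F**,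
**S** to seven named facts, exactly as recorded for Cor. 4.3 in
`rusin_sverak_minimal_data_compact_of_seven_leaves` (`RusinSverakCompactnessSevenLeaves.lean`,
whose module docstring quotes each reduction and each leaf's locator):

1. `localEnergySolution_exists_local_of_memE2` (Lemarié-Rieusset 2016 Thm. 14.1; Seregin 2014
   Prop. 1.8), 2. `localEnergySolution_extension_of_memE2` (Seregin 2014 App. B §B.5;
   Lemarié-Rieusset 2016 Thm. 14.8, proof, Steps 1–3) — together giving **E** through
   `localLeraySolution_exists_of_memE2_of_extension` and
   `leray_solution_exists_of_memLp_three_of_memE2`;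
3. `local_leray_difference_energy_estimate` (Lemarié-Rieusset 2016 Thm. 14.7, proof) — giving
   **U** through `local_leray_weak_strong_uniqueness_of`;
4. `kangMiuraTsai_pressure_decomposition` (Kang–Miura–Tsai 2021 Lemma 3.4) — giving **F** through
   `leray_solution_farField_bound_of_decomposition` with the two discharged inputs;
5. `jia_sverak_2013_lemma_2`, 6. `jia_sverak_2013_lemma_8`, 7. `localLeray_limit_isLocalLeraySolution`
   (Jia–Šverák 2013 Lemma 2, Lemma 8, proof of Thm. 1) — giving **S** through
   `jia_sverak_2013_corollary_1_of_lemma_2`, `localLeray_limiting_procedure_of_facts` and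
   `rusin_sverak_leray_singular_points_stable_of_leaves` with the discharged inputs.

This file records the weak-limit blow-up fact as a consequence of exactly these seven
undischarged named facts, with the same term as for Cor. 4.3, so that
`rusin_sverak_weak_limit_blowup_holds` is `rusin_sverak_weak_limit_blowup_of_seven_leaves` applied
to the seven `_holds` theorems once they exist (its import closure is already merged here).

## References

* W. Rusin, V. Šverák, J. Funct. Anal. 260 (2011) 879–891 = arXiv:0911.0500, proof of Cor. 4.3
  (p. 8), Thm. 4.1, Thm. 4.2, Cor. 4.2, Prop. 2.2, Lemma 2.1. [RusinSverak2011]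
* P. G. Lemarié-Rieusset, *The Navier–Stokes Problem in the 21st Century*, CRC Press 2016,
  doi:10.1201/b19556, Thms. 14.1, 14.7, 14.8, 15.1. [LemarieRieusset2016]
* H. Jia, V. Šverák, SIAM J. Math. Anal. 45 (2013) 1448–1459 = arXiv:1201.1592, Lemma 2, Cor. 1,
  Lemma 8, proof of Thm. 1. [JiaSverak2013]
* K. Kang, H. Miura, T.-P. Tsai, Int. Math. Res. Not. 2021 = arXiv:1812.10509, Lemmas 3.3–3.5.
  [KangMiuraTsai2020]
* G. Seregin, *Lecture Notes on Regularity Theory for the Navier–Stokes Equations*, World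
  Scientific 2014, App. B, Prop. 1.8 and §B.5. [Seregin2014Notes]
-/

noncomputable section

namespace Literature.Analysis.FluidPDE

/-- **Rusin–Šverák's weak-limit blow-up (proof of Cor. 4.3, sentences 2–4) over the seven
undischarged leaves of its cone.** The fact `rusin_sverak_weak_limit_blowup` follows from local
existence (1) and extension (2) of local energy solutions with `E²` data, the difference energy
estimate behind weak–strong uniqueness (3), the local pressure decomposition (4), Jia–Šverák's
Lemma 2 (5) and Lemma 8 (6), and the limit step of the local Leray limiting procedure (7); every
other input of the printed argument (Kato's local theory, its `L^∞` continuation and the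
`‖u(t)‖_∞ ≤ C/√t` bound, the local Leray property of Kato solutions, ε-regularity, RRS Lemma 15.12 /
Step 2, Prop. 2.2, the Calderón–Zygmund pressure bound, the Sobolev embedding `Ḣ^{1/2} ⊂ L³`) is a
theorem of the tree and is plugged in here or in the assemblies this term invokes.
[cite: RusinSverak2011, proof of Cor. 4.3, sentences 2–4 (arXiv:0911.0500 p. 8), with Cor. 4.2 and the paragraph after Thm. 4.1 (p. 6)] -/
theorem rusin_sverak_weak_limit_blowup_of_seven_leaves
    (h₁ : localEnergySolution_exists_local_of_memE2)
    (h₂ : localEnergySolution_extension_of_memE2)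
    (h₃ : local_leray_difference_energy_estimate)
    (h₄ : kangMiuraTsai_pressure_decomposition)
    (h₅ : jia_sverak_2013_lemma_2) (h₆ : jia_sverak_2013_lemma_8)
    (h₇ : localLeray_limit_isLocalLeraySolution) : rusin_sverak_weak_limit_blowup :=
  rusin_sverak_weak_limit_blowup_of_local_leray_leaves
    (leray_solution_exists_of_memLp_three_of_memE2
      (localLeraySolution_exists_of_memE2_of_extension h₁ h₂))
    (local_leray_weak_strong_uniqueness_of h₃) kato_isLocalLeraySolutionOn_holds
    (leray_solution_farField_bound_of_decomposition lemarieRieusset_epsilon_regularity_holds h₄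
      stein1970_normalisedPressure_ae_Lp_bound_holds)
    (rusin_sverak_leray_singular_points_stable_of_leaves (jia_sverak_2013_corollary_1_of_lemma_2 h₅)
      h₆ (localLeray_limiting_procedure_of_facts (jia_sverak_2013_corollary_1_of_lemma_2 h₅)
        rusin_sverak_2011_proposition_2_2_holds h₇)
      RRS2016.step2_force_holds RRS2016.lemma15_12_holds)

end Literature.Analysis.FluidPDE

end
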